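import Summits.BirchSwinnertonDyer.BirchSwinnertonDyer.Theorems.AlignedTransportAtTwoMainConjectureOfRankZeroBSDAtTwoCyclotomicLayerRoadMinus
import HarnessLib

/-!
# Route `AlignedTransportAtTwo`, crux C2 `MainConjectureOfRankZeroBSDAtTwo` (stmt-BirchSwinnertonDyer-22298):
# THE BINARY-DIGIT LAW (certificate-free, `p = 2`) — above `ℚ(√2)` the Mordell–Weil rank of a good ordinary `W/ℚ` grows in at most
# `ord₂ L₂(W,0) − ord_{T=−2} L₂` layers; when that many layers grow, `λ₂ = ord_{T=−2} L₂ + ∑ 2ⁿ` over the growth layers, each jump is exactly `2ⁿ`, and nothing else moves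

HONEST FRAMING (cell `bsd-f1-sign2`, WIDTH-5 attached prover seat `bsd-line-att-p5` gen 37 on line `birth` of the lead `bsd-line-att-p2`;
`--supports` stmt-BirchSwinnertonDyer-22298, closes nothing; BSD is NOT proved by any of this; the crux C2, its verdict «blocked-on
`Rank1Residual.GreenbergMuConjectureIrreducible`» and every registered stub are untouched). THEOREMS ONLY — no `def`, no `sorry`, nothing asserted about any
particular curve. PRINT binder `h17` (Kato 17.4 (1)(2) at `2`) only. NO factorisation certificate of `L₂` is used anywhere in this file (contrast the certified rows of
`…CyclotomicLayerRoadMinus{,Pairs}`): only the WEIGHT `W₀ = ord₂ L₂(W,0)` (`= 2·ord₂ #Ẽ(𝔽₂) + ord₂ [0]⁺_f`; `2` for `a₂ = +1`, `4` for `a₂ = −1` at unit symbol) and the ORDER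
`k = ord_{T=−2} L₂` at the order-`2` character.

THE POINT. Write `L₀ = (T+2)^k·H₀`, `‖H₀(0)‖₂ = 2^{−(W₀−k)}`. Every growth layer `n+1 ≥ 2` puts its weight-one prime `Ψ_n = Φ_{2^{n+1}}(1+T)` into `H₀`, all at once, so
**#{growth layers above `ℚ(√2)`} ≤ W₀ − k**, `∑ 2ⁿ ≤ λ₂ − k`; at SATURATION the cofactor of `∏ Ψ_n` is a UNIT: **`λ₂ = k + ∑_{growth n} 2ⁿ`** (the growth layers are the binary
digits of `λ₂ − k`), every jump is exactly `2ⁿ`, no other layer above `ℚ(√2)` grows. On the `a₂ = −1` road (`W₀ = 4`, `k ∈ {1,3}`, `λ₂` odd, `μ = 0`): at most THREE growth layers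
above `ℚ(√2)`; one costs `λ₂ ≥ 2ⁿ + 3`, two cost `λ₂ ≥ 2^{n₁} + 2^{n₂} + 3 ≥ 9` — so for `λ₂ ∈ {5, 7}` (1259, 3523, 4307) at most ONE, with NO `ι`-pair certificate.

* §1 (pure `Λ`-algebra) `card_le_and_sum_le_of_forall_cyclotomicLayer_dvd_cofactor`, ★ `associated_prod_cyclotomicLayer_of_card_eq` (saturation), `norm_constantCoeff_cofactor_eq`.
* §2 (any good ordinary `W/ℚ` at `2`, `h17`) ★★ `card_growthLayers_above_le` (**`#S ≤ W₀ − k`, `∑_{n∈S} 2ⁿ + k ≤ λ(G)`**), ★★★ `binaryDigitLaw_of_card_eq`.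
* §3 (`a₂ = −1` road) `card_growthLayers_above_le_three_of_negRoad`; ★★ `lam_ge_two_pow_add_three_of_negRoad_of_growth` (**`λ₂ ≥ 2ⁿ + 3`**);
  ★★ `lam_ge_of_two_growthLayers_of_negRoad` (**`λ₂ ≥ 2^{n₁} + 2^{n₂} + 3`**); `card_growthLayers_above_le_one_of_negRoad_of_lam_lt_nine` (**`λ₂ < 9 ⇒` at most one**).

References: K. Kato, Astérisque 295 (2004), Thm. 17.4 [Kato2004Asterisque]; R. Greenberg, LNM 1716 (1999), Thm. 1.9 (p. 63), §5 pp. 132, 176–177, 181 [GreenbergLNM1716];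
B. Mazur, J. Tate, J. Teitelbaum, Invent. Math. 84 (1986), §I.14 [MazurTateTeitelbaum1986Invent]; L. Washington, GTM 83, §7.1, §13.2 [Washington1997].
-/

set_option linter.dupNamespace false
set_option autoImplicit false

noncomputable section

open scoped Classical MatrixGroups ModularForm Polynomial

namespace Summit.BirchSwinnertonDyer.BirchSwinnertonDyer.Theorems.AlignedTransportAtTwoCyclotomicLayerRoadBinary

open Polynomial CongruenceSubgroup WeierstrassCurve Literature.NumberTheory.EllipticCurves
  Literature.NumberTheory.EllipticCurves.ModularForms
  Literature.NumberTheory.EllipticCurves.Rank1Residual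
  Literature.NumberTheory.EllipticCurves.Rank1Residual.Typed
  Literature.NumberTheory.EllipticCurves.Greenberg1999
  Summit.BirchSwinnertonDyer.Rank1Residual
  Summit.BirchSwinnertonDyer.Rank1Residual.X1.MuLambda
  Summit.BirchSwinnertonDyer.Rank1Residual.X1.ParitySqueeze
  Summit.BirchSwinnertonDyer.Rank1Residual.Iwasawa
  Summit.BirchSwinnertonDyer.Rank1Residual.F1Sign2
  Summit.BirchSwinnertonDyer.BirchSwinnertonDyer.Theorems.AlignedTransportAtTwoSeed
  Summit.BirchSwinnertonDyer.BirchSwinnertonDyer.Theorems.AlignedTransportAtTwoTwoFixedPoints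
  Summit.BirchSwinnertonDyer.BirchSwinnertonDyer.Theorems.AlignedTransportAtTwoRoadSecondFixedPoint
  Summit.BirchSwinnertonDyer.BirchSwinnertonDyer.Theorems.AlignedTransportAtTwoEisensteinRigidity
  Summit.BirchSwinnertonDyer.BirchSwinnertonDyer.Theorems.AlignedTransportAtTwoEisensteinRigidityConservation
  Summit.BirchSwinnertonDyer.BirchSwinnertonDyer.Theorems.AlignedTransportAtTwoEisensteinRigidityPrime
  Summit.BirchSwinnertonDyer.BirchSwinnertonDyer.Theorems.AlignedTransportAtTwoEisensteinRigidityLambdaThree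
  Summit.BirchSwinnertonDyer.BirchSwinnertonDyer.Theorems.AlignedTransportAtTwoLayerOneRankBound
  Summit.BirchSwinnertonDyer.BirchSwinnertonDyer.Theorems.AlignedTransportAtTwoCyclotomicLayerPrime
  Summit.BirchSwinnertonDyer.BirchSwinnertonDyer.Theorems.AlignedTransportAtTwoCyclotomicLayerRankDichotomy
  Summit.BirchSwinnertonDyer.BirchSwinnertonDyer.Theorems.AlignedTransportAtTwoCyclotomicLayerRankBudget
  Summit.BirchSwinnertonDyer.BirchSwinnertonDyer.Theorems.AlignedTransportAtTwoCyclotomicLayerLFunction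
  Summit.BirchSwinnertonDyer.BirchSwinnertonDyer.Theorems.AlignedTransportAtTwoCyclotomicLayerRankJumpExact
  Summit.BirchSwinnertonDyer.BirchSwinnertonDyer.Theorems.AlignedTransportAtTwoCyclotomicLayerWeight
  Summit.BirchSwinnertonDyer.BirchSwinnertonDyer.Theorems.AlignedTransportAtTwoCyclotomicLayerWeightBudget
  Summit.BirchSwinnertonDyer.BirchSwinnertonDyer.Theorems.AlignedTransportAtTwoCyclotomicLayerRoadMinus
  Summit.BirchSwinnertonDyer.BirchSwinnertonDyer.Theorems.DefectPrime

/-! ## §1 Pure `Λ`-algebra at `p = 2`: the layer primes inside a cofactor of weight `w` -/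

section Algebra

/-- An element of `ℤ₂⟦T⟧` whose constant term has norm `2^{−w}` is non-zero. [folklore] -/
theorem ne_zero_of_norm_constantCoeff_eq_pow {H : PowerSeries ℤ_[2]} {w : ℕ} (hw : ‖PowerSeries.constantCoeff H‖ = (2 : ℝ)⁻¹ ^ w) : H ≠ 0 := by
  intro h0
  rw [h0, map_zero, norm_zero] at hw
  exact (ne_of_gt (by positivity : (0 : ℝ) < (2 : ℝ)⁻¹ ^ w)) hw.symm

/-- **The layer primes `Ψ_n` (`n ∈ S`, all `n ≥ 1`) dividing `(T+2)^k·H₀` divide `H₀`; if `‖H₀(0)‖₂ = 2^{−w}` then `#S ≤ w` and `∑_{n∈S} 2ⁿ ≤ λ(H₀)`.**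
[cite: Washington1997, §7.1 and §13.2] -/
theorem card_le_and_sum_le_of_forall_cyclotomicLayer_dvd_cofactor (S : Finset ℕ) (hS1 : ∀ n ∈ S, 1 ≤ n) {k w : ℕ} {H₀ : PowerSeries ℤ_[2]}
    (hw : ‖PowerSeries.constantCoeff H₀‖ = (2 : ℝ)⁻¹ ^ w)
    (h : ∀ n ∈ S, (((cyclotomic (2 ^ (n + 1)) ℤ_[2]).comp (X + 1) : ℤ_[2][X]) : PowerSeries ℤ_[2]) ∣
      (PowerSeries.X + PowerSeries.C (2 : ℤ_[2])) ^ k * H₀) :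
    (∀ n ∈ S, (((cyclotomic (2 ^ (n + 1)) ℤ_[2]).comp (X + 1) : ℤ_[2][X]) : PowerSeries ℤ_[2]) ∣ H₀) ∧ S.card ≤ w ∧
      ∑ n ∈ S, 2 ^ n ≤ lam H₀ := by
  have h' : ∀ n ∈ S, (((cyclotomic (2 ^ (n + 1)) ℤ_[2]).comp (X + 1) : ℤ_[2][X]) : PowerSeries ℤ_[2]) ∣ H₀ :=
    fun n hn ↦ cyclotomicLayer_dvd_of_dvd_X_add_C_two_pow_mul (hS1 n hn) (h n hn)
  have hw' : ‖PowerSeries.constantCoeff H₀‖ = ((2 : ℕ) : ℝ)⁻¹ ^ w := by rw [hw]; norm_num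
  have hH0 : H₀ ≠ 0 := ne_zero_of_norm_constantCoeff_eq_pow hw
  refine ⟨h', card_le_of_forall_cyclotomicLayer_dvd S hw' h', ?_⟩
  have hs := sum_totient_le_lam_of_forall_dvd S hH0 h'
  simpa using hs

/-- ★ **SATURATION: `‖H₀(0)‖₂ = 2^{−#S}` and `Ψ_n ∣ H₀` for all `n ∈ S` ⇒ `H₀ ~ ∏_{n∈S} Ψ_n`, `λ(H₀) = ∑_{n∈S} 2ⁿ`, and `Ψ_n² ∤ H₀` for `n ∈ S`.** The cofactor `R` in
`H₀ = ∏ Ψ_n · R` (g36 `prod_cyclotomicLayer_dvd_of_forall_dvd`) has `‖R(0)‖ = 1`, i.e. is a unit of `Λ`. [cite: Washington1997, §7.1 and §13.2] -/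
theorem associated_prod_cyclotomicLayer_of_card_eq (S : Finset ℕ) {H₀ : PowerSeries ℤ_[2]}
    (hw : ‖PowerSeries.constantCoeff H₀‖ = (2 : ℝ)⁻¹ ^ S.card)
    (h : ∀ n ∈ S, (((cyclotomic (2 ^ (n + 1)) ℤ_[2]).comp (X + 1) : ℤ_[2][X]) : PowerSeries ℤ_[2]) ∣ H₀) :
    Associated (∏ n ∈ S, (((cyclotomic (2 ^ (n + 1)) ℤ_[2]).comp (X + 1) : ℤ_[2][X]) : PowerSeries ℤ_[2])) H₀ ∧
      lam H₀ = ∑ n ∈ S, 2 ^ n ∧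
      ∀ n ∈ S, ¬ (((cyclotomic (2 ^ (n + 1)) ℤ_[2]).comp (X + 1) : ℤ_[2][X]) : PowerSeries ℤ_[2]) ^ 2 ∣ H₀ := by
  obtain ⟨R, hR⟩ := prod_cyclotomicLayer_dvd_of_forall_dvd S h
  have hP0 : (∏ n ∈ S, (((cyclotomic (2 ^ (n + 1)) ℤ_[2]).comp (X + 1) : ℤ_[2][X]) : PowerSeries ℤ_[2])) ≠ 0 :=
    Finset.prod_ne_zero_iff.mpr fun n _ ↦ (prime_coe_cyclotomic_comp 2 n).ne_zero
  -- `‖R(0)‖ = 1`, so `R` is a unit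
  have hnorm : ‖PowerSeries.constantCoeff H₀‖ = (2 : ℝ)⁻¹ ^ S.card * ‖PowerSeries.constantCoeff R‖ := by
    rw [hR, map_mul, norm_mul, norm_constantCoeff_prod_cyclotomicLayer]; norm_num
  have hR1 : ‖PowerSeries.constantCoeff R‖ = 1 := by
    rw [hw] at hnorm
    have hpos : (0 : ℝ) < (2 : ℝ)⁻¹ ^ S.card := by positivity
    have := mul_left_cancel₀ hpos.ne' (hnorm.symm.trans (mul_one _).symm)
    exact this
  have hRu : IsUnit R := PowerSeries.isUnit_iff_constantCoeff.mpr (PadicInt.isUnit_iff.mpr hR1)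
  have hR0 : R ≠ 0 := hRu.ne_zero
  refine ⟨⟨hRu.unit, by rw [IsUnit.unit_spec, hR]⟩, ?_, ?_⟩
  · rw [hR, lam_mul hP0 hR0, lam_prod_cyclotomicLayer, AlignedTransportAtTwoEisensteinRigidity.lam_eq_zero_of_isUnit hRu, add_zero]
    simp
  · intro n hn h2
    have hΨ := prime_coe_cyclotomic_comp 2 n
    rw [hR, ← Finset.mul_prod_erase S _ hn, pow_two, mul_assoc] at h2
    have h3 := (mul_dvd_mul_iff_left hΨ.ne_zero).mp h2
    rcases hΨ.dvd_or_dvd h3 with h4 | h4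
    · obtain ⟨m, hm, hdvd⟩ := hΨ.exists_mem_finset_dvd h4
      exact (Finset.ne_of_mem_erase hm) (eq_of_cyclotomicLayer_dvd hdvd).symm
    · exact hΨ.not_unit (isUnit_of_dvd_unit h4 hRu)

/-- **The weight of the cofactor**: `G = (T+2)^k·H₀`, `‖G(0)‖₂ = 2^{−W₀}` ⇒ `k ≤ W₀` and `‖H₀(0)‖₂ = 2^{−(W₀−k)}`. [folklore] -/
theorem norm_constantCoeff_cofactor_eq {G H₀ : PowerSeries ℤ_[2]} {k W₀ : ℕ} (hGH : G = (PowerSeries.X + PowerSeries.C (2 : ℤ_[2])) ^ k * H₀)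
    (hw : ‖PowerSeries.constantCoeff G‖ = (2 : ℝ)⁻¹ ^ W₀) :
    k ≤ W₀ ∧ ‖PowerSeries.constantCoeff H₀‖ = (2 : ℝ)⁻¹ ^ (W₀ - k) := by
  have hH00 : PowerSeries.constantCoeff H₀ ≠ 0 := by
    intro h0
    rw [hGH, map_mul, h0, mul_zero, norm_zero] at hw
    exact (ne_of_gt (by positivity : (0 : ℝ) < (2 : ℝ)⁻¹ ^ W₀)) hw.symm
  have hv : ‖PowerSeries.constantCoeff H₀‖ = (2 : ℝ)⁻¹ ^ (PowerSeries.constantCoeff H₀).valuation := norm_eq_inv_pow_valuation hH00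
  have h1 : ‖PowerSeries.constantCoeff G‖ = (2 : ℝ)⁻¹ ^ (k + (PowerSeries.constantCoeff H₀).valuation) := by
    rw [hGH, map_mul, norm_mul, norm_constantCoeff_X_add_C_two_pow, hv, pow_add]
  rw [hw] at h1
  have hkv : W₀ = k + (PowerSeries.constantCoeff H₀).valuation :=
    pow_right_injective₀ (by norm_num : (0 : ℝ) < 2⁻¹) (by norm_num : (2 : ℝ)⁻¹ ≠ 1) h1
  refine ⟨by omega, ?_⟩
  rw [hv]
  congr 1
  omega

end Algebra

/-! ## §2 Any good ordinary `W/ℚ` at `2` (PRINT `h17`): `#growth layers above ℚ(√2) ≤ W₀ − k`; saturation ⇒ the binary-digit law -/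

variable (V : WeierstrassCurve ℚ) [V.IsElliptic] [V.IsGloballyMinimal]

/-- ★★ **AT MOST `W₀ − k` GROWTH LAYERS ABOVE `ℚ(√2)`.** `V/ℚ` globally minimal, good ordinary at `2`, `f` a newform of `V` (any level) with PRINT `h17` at `2`; `G` an integral lift of
`L₂(f,α)` with `‖G(0)‖₂ = 2^{−W₀}` and `ord_{T=−2} G = k` (`HasOrderAtNegTwo`); `κ` the cyclotomic `ℤ₂`-extension with normalised generator. For every finite set `S` of layers `n ≥ 1`
with `rank V(ℚ_n) < rank V(ℚ_{n+1})`: **`#S ≤ W₀ − k`** and **`∑_{n∈S} 2ⁿ + k ≤ λ(G)`** (also `k ≤ W₀`). No factorisation certificate.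
[cite: Kato2004Asterisque, Thm. 17.4 (1)(2) (p. 273)] [cite: GreenbergLNM1716, Thm. 1.9 (p. 63) and §5 p. 132] -/
theorem card_growthLayers_above_le {N : ℕ} [NeZero N] {f : CuspForm (Gamma0 N) 2}
    (h17 : kato_divisibility_allPrimes V 2 (f := f)) (hord : IsOrdinaryAt V 2) (hf : IsNewformOf V f)
    {G : IwasawaAlgebra 2} (hG : iwasawaToPowerSeries 2 G = padicLFunction f (unitRoot V 2 : ℚ_[2])) {k W₀ : ℕ} (hk : HasOrderAtNegTwo G k)
    (hw : ‖PowerSeries.constantCoeff G‖ = (2 : ℝ)⁻¹ ^ W₀)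
    {κ : ZpExtension ℚ 2} {γ : Field.absoluteGaloisGroup ℚ} (hκ : κ.IsCyclotomic) (hγ : κ.IsTopGenerator γ)
    (hγ' : IsCyclotomicVariable 2 γ) (S : Finset ℕ) (hS1 : ∀ n ∈ S, 1 ≤ n)
    (hS : ∀ n ∈ S, (V.baseChange (κ.layer n)).mordellWeilRank < (V.baseChange (κ.layer (n + 1))).mordellWeilRank) :
    k ≤ W₀ ∧ S.card ≤ W₀ - k ∧ ∑ n ∈ S, 2 ^ n + k ≤ lam G := by
  obtain ⟨H₀, hGH⟩ := hk.1
  obtain ⟨hkW, hH₀w⟩ := norm_constantCoeff_cofactor_eq hGH hw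
  have hdvd : ∀ n ∈ S, (((cyclotomic (2 ^ (n + 1)) ℤ_[2]).comp (X + 1) : ℤ_[2][X]) : PowerSeries ℤ_[2]) ∣
      (PowerSeries.X + PowerSeries.C (2 : ℤ_[2])) ^ k * H₀ := fun n hn ↦ by
    rw [← hGH]; exact cyclotomicLayer_dvd_lift_of_mordellWeilRank_lt V h17 hord hf hG hκ hγ hγ' (hS n hn)
  obtain ⟨-, hcard, hsum⟩ := card_le_and_sum_le_of_forall_cyclotomicLayer_dvd_cofactor S hS1 hH₀w hdvd
  have hH00 : H₀ ≠ 0 := ne_zero_of_norm_constantCoeff_eq_pow hH₀w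
  have hlamG : lam G = k + lam H₀ := by
    rw [hGH, lam_mul (pow_ne_zero _ prime_X_add_C_two.ne_zero) hH00, lam_X_add_C_two_pow]
  exact ⟨hkW, hcard, by omega⟩

/-- ★★★ **THE BINARY-DIGIT LAW (saturation).** Hypotheses of `card_growthLayers_above_le`; suppose EXACTLY `W₀ − k` layers `n+1 ≥ 2` (`n ∈ S`) show growth. Then
**`λ(G) = k + ∑_{n∈S} 2ⁿ`** (the growth layers are the binary digits of `λ₂ − k`), **every jump is exact: `rank V(ℚ_{n+1}) = rank V(ℚ_n) + 2ⁿ` for `n ∈ S`**, and **no other layer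
above the first grows**: `rank V(ℚ_{n+1}) = rank V(ℚ_n)` for every `n ≥ 1`, `n ∉ S`. (The cofactor of `(T+2)^k·∏_S Ψ_n` in `L₀` has weight zero, hence is a unit of `Λ`.)
[cite: Kato2004Asterisque, Thm. 17.4 (1)(2) (p. 273) and Thm. 18.4 (p. 281)] [cite: GreenbergLNM1716, Thm. 1.9 (p. 63) and §5 pp. 132, 177] -/
theorem binaryDigitLaw_of_card_eq {N : ℕ} [NeZero N] {f : CuspForm (Gamma0 N) 2}
    (h17 : kato_divisibility_allPrimes V 2 (f := f)) (hord : IsOrdinaryAt V 2) (hf : IsNewformOf V f)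
    {G : IwasawaAlgebra 2} (hG : iwasawaToPowerSeries 2 G = padicLFunction f (unitRoot V 2 : ℚ_[2])) {k W₀ : ℕ} (hk : HasOrderAtNegTwo G k)
    (hw : ‖PowerSeries.constantCoeff G‖ = (2 : ℝ)⁻¹ ^ W₀)
    {κ : ZpExtension ℚ 2} {γ : Field.absoluteGaloisGroup ℚ} (hκ : κ.IsCyclotomic) (hγ : κ.IsTopGenerator γ)
    (hγ' : IsCyclotomicVariable 2 γ) (S : Finset ℕ) (hS1 : ∀ n ∈ S, 1 ≤ n)
    (hS : ∀ n ∈ S, (V.baseChange (κ.layer n)).mordellWeilRank < (V.baseChange (κ.layer (n + 1))).mordellWeilRank) (hcard : S.card = W₀ - k) :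
    lam G = k + ∑ n ∈ S, 2 ^ n ∧
      (∀ n ∈ S, (V.baseChange (κ.layer (n + 1))).mordellWeilRank = (V.baseChange (κ.layer n)).mordellWeilRank + 2 ^ n) ∧
      (∀ n, 1 ≤ n → n ∉ S → (V.baseChange (κ.layer (n + 1))).mordellWeilRank = (V.baseChange (κ.layer n)).mordellWeilRank) := by
  obtain ⟨H₀, hGH⟩ := hk.1
  obtain ⟨hkW, hH₀w⟩ := norm_constantCoeff_cofactor_eq hGH hw
  have hdvd : ∀ n ∈ S, (((cyclotomic (2 ^ (n + 1)) ℤ_[2]).comp (X + 1) : ℤ_[2][X]) : PowerSeries ℤ_[2]) ∣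
      (PowerSeries.X + PowerSeries.C (2 : ℤ_[2])) ^ k * H₀ := fun n hn ↦ by
    rw [← hGH]; exact cyclotomicLayer_dvd_lift_of_mordellWeilRank_lt V h17 hord hf hG hκ hγ hγ' (hS n hn)
  obtain ⟨hdvd', -, -⟩ := card_le_and_sum_le_of_forall_cyclotomicLayer_dvd_cofactor S hS1 hH₀w hdvd
  rw [← hcard] at hH₀w
  obtain ⟨hass, hlamH, hsq⟩ := associated_prod_cyclotomicLayer_of_card_eq S hH₀w hdvd'
  have hH00 : H₀ ≠ 0 := ne_zero_of_norm_constantCoeff_eq_pow hH₀w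
  have hlamG : lam G = k + lam H₀ := by
    rw [hGH, lam_mul (pow_ne_zero _ prime_X_add_C_two.ne_zero) hH00, lam_X_add_C_two_pow]
  -- exact jumps at the growth layers
  have hjump : ∀ n ∈ S, (V.baseChange (κ.layer (n + 1))).mordellWeilRank = (V.baseChange (κ.layer n)).mordellWeilRank + 2 ^ n := by
    intro n hn
    obtain ⟨c, hc, hrk⟩ := exists_cyclotomicLayer_pow_dvd_lift_and_mordellWeilRank_eq V h17 hord hf hG hκ hγ hγ' n
    have hrk' : (V.baseChange (κ.layer (n + 1))).mordellWeilRank = (V.baseChange (κ.layer n)).mordellWeilRank + 2 ^ n * (2 - 1) * c := hrk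
    have hlt := hS n hn
    have hc1 : c ≤ 1 := by
      by_contra hlt'
      have h2 : (((cyclotomic (2 ^ (n + 1)) ℤ_[2]).comp (X + 1) : ℤ_[2][X]) : PowerSeries ℤ_[2]) ^ 2 ∣
          (PowerSeries.X + PowerSeries.C (2 : ℤ_[2])) ^ k * H₀ := by
        rw [← hGH]; exact dvd_trans (pow_dvd_pow _ (by omega)) hc
      exact hsq n hn ((prime_coe_cyclotomic_comp 2 n).pow_dvd_of_dvd_mul_left 2 (not_cyclotomicLayer_dvd_X_add_C_two_pow (hS1 n hn) k) h2)
    have hc0 : c ≠ 0 := by rintro rfl; simp at hrk'; omega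
    have hc1' : c = 1 := by omega
    subst hc1'
    simpa using hrk'
  refine ⟨by rw [hlamG, hlamH], hjump, ?_⟩
  -- no growth at any other layer above the first: it would be one layer prime too many for the weight
  intro n hn1 hnS
  by_contra hne
  have hlt : (V.baseChange (κ.layer n)).mordellWeilRank < (V.baseChange (κ.layer (n + 1))).mordellWeilRank :=
    lt_of_le_of_ne (mordellWeilRank_layer_le_succ V κ n) (Ne.symm hne)
  have h := card_growthLayers_above_le V h17 hord hf hG hk hw hκ hγ hγ' (insert n S)
    (fun m hm ↦ by rcases Finset.mem_insert.mp hm with rfl | hm; exacts [hn1, hS1 m hm])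
    (fun m hm ↦ by rcases Finset.mem_insert.mp hm with rfl | hm; exacts [hlt, hS m hm])
  rw [Finset.card_insert_of_notMem hnS] at h
  omega

/-! ## §3 The `a₂ = −1` road (`W₀ = 4`, `k = ord₋₂ L₂ ∈ {1, 3}`, `λ₂` odd): at most three growth layers above `ℚ(√2)`; the cost of one and of two -/

variable (W : WeierstrassCurve ℚ) [W.IsElliptic] [W.IsGloballyMinimal]

/-- **On the `a₂ = −1` road at unit symbol, AT MOST THREE layers above `ℚ(√2)` show Mordell–Weil growth** (`W₀ = 4`, `k = ord_{T=−2} L₂ ≥ 1`); `≤ 4 − k` in general, so at most ONE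
when `ord₋₂ L₂ = 3`. `W/ℚ` globally minimal, good ordinary at `2`, `a₂ = −1`, `∏ c_v` odd, `Δ_min ≡ 3,5 (8)`, `r_an = 0`, `f` its newform at level `N_W` with `‖[0]⁺_f‖₂ = 1`, `G` an
integral lift with `ord_{T=−2} G = k`; PRINT `h17`. No certificate. [cite: Kato2004Asterisque, Thm. 17.4 (1)(2) (p. 273)] [cite: GreenbergLNM1716, §5 pp. 132 and 181] -/
theorem card_growthLayers_above_le_three_of_negRoad [NeZero (W.conductorNorm ℤ)] {f : CuspForm (Gamma0 (W.conductorNorm ℤ)) 2}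
    (h17 : kato_divisibility_allPrimes W 2 (f := f)) (hord : IsOrdinaryAt W 2) (hf : IsNewformOf W f) (hr : W.analyticRank = 0)
    (ha : W.frobeniusTrace 2 = -1) (hodd : Odd W.tamagawaProduct) (hΔ : minimalDiscriminantInt W % 8 = 3 ∨ minimalDiscriminantInt W % 8 = 5)
    {G : IwasawaAlgebra 2} (hG : iwasawaToPowerSeries 2 G = padicLFunction f (unitRoot W 2 : ℚ_[2])) {k : ℕ} (hk : HasOrderAtNegTwo G k)
    (hsym : ‖(ratPlusSymbol f 0 : ℚ_[2])‖ = 1)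
    {κ : ZpExtension ℚ 2} {γ : Field.absoluteGaloisGroup ℚ} (hκ : κ.IsCyclotomic) (hγ : κ.IsTopGenerator γ)
    (hγ' : IsCyclotomicVariable 2 γ) (S : Finset ℕ) (hS1 : ∀ n ∈ S, 1 ≤ n)
    (hS : ∀ n ∈ S, (W.baseChange (κ.layer n)).mordellWeilRank < (W.baseChange (κ.layer (n + 1))).mordellWeilRank) :
    S.card ≤ 4 - k ∧ 1 ≤ k ∧ S.card ≤ 3 ∧ ∑ n ∈ S, 2 ^ n + k ≤ lam G := by
  have hw : ‖PowerSeries.constantCoeff G‖ = (2 : ℝ)⁻¹ ^ (3 + 1) := norm_constantCoeff_lift_of_frobeniusTrace_eq_neg_one W hord hf ha hG hsym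
  obtain ⟨-, hcard, hsum⟩ := card_growthLayers_above_le W h17 hord hf hG hk hw hκ hγ hγ' S hS1 hS
  have hk13 := orderAtNegTwo_eq_one_or_three_of_road_of_frobeniusTrace_eq_neg_one hord hf ha hodd hΔ hr hG hsym hk
  refine ⟨hcard, by omega, by omega, hsum⟩

/-- ★★ **GROWTH AT A LAYER `n+1 ≥ 2` ON THE `a₂ = −1`, `ord₋₂ = 1` ROAD COSTS `λ₂ ≥ 2ⁿ + 3`** (hypotheses of `card_growthLayers_above_le_three_of_negRoad` with `k = 1` and `μ(G) = 0`):
`L₀ = (T+2)·Ψ_n·R` with `R` of weight `2`; `λ(R)` is even (`λ₂` odd) and non-zero (`λ(R) = 0 = μ(R)` would make `R` a unit, of weight `0`), so `λ(R) ≥ 2`. Sharper than g36's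
certificate-free `2ⁿ + 1`, and equal to the certified rows' `= 2ⁿ + 3` as a lower bound. [cite: Kato2004Asterisque, Thm. 17.4 (1)(2) (p. 273)] [cite: GreenbergLNM1716, §5 pp. 177 and 181] -/
theorem lam_ge_two_pow_add_three_of_negRoad_of_growth [NeZero (W.conductorNorm ℤ)] {f : CuspForm (Gamma0 (W.conductorNorm ℤ)) 2}
    (h17 : kato_divisibility_allPrimes W 2 (f := f)) (hord : IsOrdinaryAt W 2) (hf : IsNewformOf W f)
    (ha : W.frobeniusTrace 2 = -1) (hodd : Odd W.tamagawaProduct) (hΔ : minimalDiscriminantInt W % 8 = 3 ∨ minimalDiscriminantInt W % 8 = 5)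
    {G : IwasawaAlgebra 2} (hG : iwasawaToPowerSeries 2 G = padicLFunction f (unitRoot W 2 : ℚ_[2])) (hμ : mu G = 0) (h1 : HasOrderAtNegTwo G 1)
    (hsym : ‖(ratPlusSymbol f 0 : ℚ_[2])‖ = 1)
    {κ : ZpExtension ℚ 2} {γ : Field.absoluteGaloisGroup ℚ} (hκ : κ.IsCyclotomic) (hγ : κ.IsTopGenerator γ)
    (hγ' : IsCyclotomicVariable 2 γ) {n : ℕ} (hn : 1 ≤ n)
    (hlt : (W.baseChange (κ.layer n)).mordellWeilRank < (W.baseChange (κ.layer (n + 1))).mordellWeilRank) :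
    2 ^ n + 3 ≤ lam G := by
  have hX : Prime (PowerSeries.X + PowerSeries.C (2 : ℤ_[2]) : PowerSeries ℤ_[2]) := prime_X_add_C_two
  have hG0 : G ≠ 0 := by
    intro h0
    rw [h0, map_zero] at hG
    exact padicLFunction_unitRoot_ne_zero hord hf hG.symm
  have hG1 : iwasawaToPowerSeries 2 G = PowerSeries.C (1 : ℚ_[2]) * padicLFunction f (unitRoot W 2 : ℚ_[2]) := by
    rw [map_one, one_mul]; exact hG
  have hw : ‖PowerSeries.constantCoeff G‖ = (2 : ℝ)⁻¹ ^ (3 + 1) := norm_constantCoeff_lift_of_frobeniusTrace_eq_neg_one W hord hf ha hG hsym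
  obtain ⟨H₀, hGH⟩ := h1.1
  obtain ⟨-, hH₀w⟩ := norm_constantCoeff_cofactor_eq hGH hw
  have hΨ := prime_coe_cyclotomic_comp 2 n
  have hdvd : (((cyclotomic (2 ^ (n + 1)) ℤ_[2]).comp (X + 1) : ℤ_[2][X]) : PowerSeries ℤ_[2]) ∣ H₀ := by
    apply cyclotomicLayer_dvd_of_dvd_X_add_C_two_pow_mul hn (k := 1)
    rw [← hGH]; exact cyclotomicLayer_dvd_lift_of_mordellWeilRank_lt W h17 hord hf hG hκ hγ hγ' hlt
  obtain ⟨R, hR⟩ := hdvd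
  have hH00 : H₀ ≠ 0 := by rintro h0; exact hG0 (by rw [hGH, h0, mul_zero])
  have hR0 : R ≠ 0 := by rintro rfl; exact hH00 (by rw [hR, mul_zero])
  -- `λ(G) = 1 + 2ⁿ + λ(R)`, `μ(R) = 0`
  have hlamG : lam G = 1 + (2 ^ n + lam R) := by
    rw [hGH, pow_one, lam_mul hX.ne_zero hH00, lam_X_add_C_two, hR, lam_mul hΨ.ne_zero hR0, lam_cyclotomicLayer_two]
  have hμR : mu R = 0 := by
    have h := mu_mul hX.ne_zero hH00
    rw [← pow_one (PowerSeries.X + PowerSeries.C (2 : ℤ_[2])), ← hGH, hμ, pow_one, mu_X_add_C_two_and_pfree.1, hR, mu_mul hΨ.ne_zero hR0,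
      (mu_coe_cyclotomic_comp 2 n).1] at h
    omega
  have hRw : ‖PowerSeries.constantCoeff R‖ = (2 : ℝ)⁻¹ ^ 2 := by
    have h := hH₀w
    rw [hR, map_mul, norm_mul, norm_constantCoeff_cyclotomicLayer] at h
    norm_num at h ⊢
    linarith
  have hRnu : ¬ IsUnit R := by
    intro hu
    have h1 : ‖PowerSeries.constantCoeff R‖ = 1 := PadicInt.isUnit_iff.mp (PowerSeries.isUnit_iff_constantCoeff.mp hu)
    rw [hRw] at h1; norm_num at h1
  have hlamR0 : lam R ≠ 0 := fun h0 ↦ hRnu ((isUnit_iff_mu_eq_zero_and_lam_eq_zero R).mpr ⟨hR0, hμR, h0⟩)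
  -- parity: `λ(G)` odd, `2ⁿ` even ⇒ `λ(R)` even ⇒ `λ(R) ≥ 2`
  have hoddG : Odd (lam G) := odd_lam_of_road hord hf hodd hΔ hG1 hG0
  have h2n : Even (2 ^ n) := (Nat.even_pow' (by omega)).mpr even_two
  obtain ⟨b, hb⟩ := hoddG
  obtain ⟨c, hc⟩ := h2n
  omega

/-- ★★ **TWO GROWTH LAYERS `n₁ + 1 < n₂ + 1` (both `≥ 2`) ON THE `a₂ = −1`, `ord₋₂ = 1` ROAD COST `λ₂ ≥ 2^{n₁} + 2^{n₂} + 3`** (same hypotheses): `L₀ = (T+2)·Ψ_{n₁}·Ψ_{n₂}·R′` with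
`R′` of weight one, `μ(R′) = 0`, so `λ(R′) ≥ 1`, and even by parity, so `≥ 2`. Hence for `λ₂ ≤ 7` at most ONE layer above `ℚ(√2)` grows — certificate-free (the certified `ι`-pair
rows pin WHICH layer). [cite: Kato2004Asterisque, Thm. 17.4 (1)(2) (p. 273)] [cite: GreenbergLNM1716, §5 pp. 177 and 181] -/
theorem lam_ge_of_two_growthLayers_of_negRoad [NeZero (W.conductorNorm ℤ)] {f : CuspForm (Gamma0 (W.conductorNorm ℤ)) 2}
    (h17 : kato_divisibility_allPrimes W 2 (f := f)) (hord : IsOrdinaryAt W 2) (hf : IsNewformOf W f)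
    (ha : W.frobeniusTrace 2 = -1) (hodd : Odd W.tamagawaProduct) (hΔ : minimalDiscriminantInt W % 8 = 3 ∨ minimalDiscriminantInt W % 8 = 5)
    {G : IwasawaAlgebra 2} (hG : iwasawaToPowerSeries 2 G = padicLFunction f (unitRoot W 2 : ℚ_[2])) (hμ : mu G = 0) (h1 : HasOrderAtNegTwo G 1)
    (hsym : ‖(ratPlusSymbol f 0 : ℚ_[2])‖ = 1)
    {κ : ZpExtension ℚ 2} {γ : Field.absoluteGaloisGroup ℚ} (hκ : κ.IsCyclotomic) (hγ : κ.IsTopGenerator γ)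
    (hγ' : IsCyclotomicVariable 2 γ) {n₁ n₂ : ℕ} (hn₁ : 1 ≤ n₁) (hlt12 : n₁ < n₂)
    (hlt₁ : (W.baseChange (κ.layer n₁)).mordellWeilRank < (W.baseChange (κ.layer (n₁ + 1))).mordellWeilRank)
    (hlt₂ : (W.baseChange (κ.layer n₂)).mordellWeilRank < (W.baseChange (κ.layer (n₂ + 1))).mordellWeilRank) :
    2 ^ n₁ + 2 ^ n₂ + 3 ≤ lam G := by
  have hX : Prime (PowerSeries.X + PowerSeries.C (2 : ℤ_[2]) : PowerSeries ℤ_[2]) := prime_X_add_C_two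
  have hG0 : G ≠ 0 := by
    intro h0
    rw [h0, map_zero] at hG
    exact padicLFunction_unitRoot_ne_zero hord hf hG.symm
  have hG1 : iwasawaToPowerSeries 2 G = PowerSeries.C (1 : ℚ_[2]) * padicLFunction f (unitRoot W 2 : ℚ_[2]) := by
    rw [map_one, one_mul]; exact hG
  have hw : ‖PowerSeries.constantCoeff G‖ = (2 : ℝ)⁻¹ ^ (3 + 1) := norm_constantCoeff_lift_of_frobeniusTrace_eq_neg_one W hord hf ha hG hsym
  obtain ⟨H₀, hGH⟩ := h1.1
  obtain ⟨-, hH₀w⟩ := norm_constantCoeff_cofactor_eq hGH hw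
  let S : Finset ℕ := {n₁, n₂}
  have hn12 : n₁ ≠ n₂ := Nat.ne_of_lt hlt12
  have hS1 : ∀ n ∈ S, 1 ≤ n := fun n hn ↦ by
    rcases Finset.mem_insert.mp hn with rfl | hn; · exact hn₁
    rw [Finset.mem_singleton] at hn; omega
  have hdvd : ∀ n ∈ S, (((cyclotomic (2 ^ (n + 1)) ℤ_[2]).comp (X + 1) : ℤ_[2][X]) : PowerSeries ℤ_[2]) ∣
      (PowerSeries.X + PowerSeries.C (2 : ℤ_[2])) ^ 1 * H₀ := fun n hn ↦ by
    rw [← hGH]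
    rcases Finset.mem_insert.mp hn with rfl | hn
    · exact cyclotomicLayer_dvd_lift_of_mordellWeilRank_lt W h17 hord hf hG hκ hγ hγ' hlt₁
    · rw [Finset.mem_singleton] at hn; subst hn
      exact cyclotomicLayer_dvd_lift_of_mordellWeilRank_lt W h17 hord hf hG hκ hγ hγ' hlt₂
  obtain ⟨hdvd', -, -⟩ := card_le_and_sum_le_of_forall_cyclotomicLayer_dvd_cofactor S hS1 hH₀w hdvd
  obtain ⟨R, hR⟩ := prod_cyclotomicLayer_dvd_of_forall_dvd S hdvd'
  have hP0 : (∏ n ∈ S, (((cyclotomic (2 ^ (n + 1)) ℤ_[2]).comp (X + 1) : ℤ_[2][X]) : PowerSeries ℤ_[2])) ≠ 0 :=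
    Finset.prod_ne_zero_iff.mpr fun n _ ↦ (prime_coe_cyclotomic_comp 2 n).ne_zero
  have hH00 : H₀ ≠ 0 := by rintro h0; exact hG0 (by rw [hGH, h0, mul_zero])
  have hR0 : R ≠ 0 := by rintro rfl; exact hH00 (by rw [hR, mul_zero])
  have hcardS : S.card = 2 := by
    rw [Finset.card_insert_of_notMem (by rwa [Finset.mem_singleton]), Finset.card_singleton]
  have hsumS : ∑ n ∈ S, 2 ^ n * (2 - 1) = 2 ^ n₁ + 2 ^ n₂ := by
    rw [Finset.sum_insert (by rwa [Finset.mem_singleton]), Finset.sum_singleton]; simp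
  -- `λ(G) = 1 + (2^{n₁} + 2^{n₂}) + λ(R)`, `μ(R) = 0`, weight of `R` is one
  have hlamG : lam G = 1 + ((2 ^ n₁ + 2 ^ n₂) + lam R) := by
    rw [hGH, pow_one, lam_mul hX.ne_zero hH00, lam_X_add_C_two, hR, lam_mul hP0 hR0, lam_prod_cyclotomicLayer, hsumS]
  have hμR : mu R = 0 := by
    have h := mu_mul hX.ne_zero hH00
    rw [← pow_one (PowerSeries.X + PowerSeries.C (2 : ℤ_[2])), ← hGH, hμ, pow_one, mu_X_add_C_two_and_pfree.1, hR, mu_mul hP0 hR0] at h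
    omega
  have hRw : ‖PowerSeries.constantCoeff R‖ = (2 : ℝ)⁻¹ := by
    have h := hH₀w
    rw [hR, map_mul, norm_mul, norm_constantCoeff_prod_cyclotomicLayer, hcardS] at h
    norm_num at h ⊢
    linarith
  have hRnu : ¬ IsUnit R := by
    intro hu
    have h1 : ‖PowerSeries.constantCoeff R‖ = 1 := PadicInt.isUnit_iff.mp (PowerSeries.isUnit_iff_constantCoeff.mp hu)
    rw [hRw] at h1; norm_num at h1
  have hlamR0 : lam R ≠ 0 := fun h0 ↦ hRnu ((isUnit_iff_mu_eq_zero_and_lam_eq_zero R).mpr ⟨hR0, hμR, h0⟩)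
  have hoddG : Odd (lam G) := odd_lam_of_road hord hf hodd hΔ hG1 hG0
  have h2n₁ : Even (2 ^ n₁) := (Nat.even_pow' (by omega)).mpr even_two
  have h2n₂ : Even (2 ^ n₂) := (Nat.even_pow' (by omega)).mpr even_two
  obtain ⟨b, hb⟩ := hoddG
  obtain ⟨c₁, hc₁⟩ := h2n₁
  obtain ⟨c₂, hc₂⟩ := h2n₂
  omega

/-- ★ **`λ₂ ≤ 7` (or `λ₂ < 9`) ON THE `a₂ = −1`, `ord₋₂ = 1` ROAD ⇒ AT MOST ONE LAYER ABOVE `ℚ(√2)` SHOWS MORDELL–WEIL GROWTH** — certificate-free (no `ι`-pair primality): any two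
growth layers would cost `λ₂ ≥ 2 + 4 + 3 = 9`. For every finite set `S` of growth layers `n ≥ 1`: `#S ≤ 1`. [cite: Kato2004Asterisque, Thm. 17.4 (1)(2) (p. 273)]
[cite: GreenbergLNM1716, §5 pp. 177 and 181] -/
theorem card_growthLayers_above_le_one_of_negRoad_of_lam_lt_nine [NeZero (W.conductorNorm ℤ)] {f : CuspForm (Gamma0 (W.conductorNorm ℤ)) 2}
    (h17 : kato_divisibility_allPrimes W 2 (f := f)) (hord : IsOrdinaryAt W 2) (hf : IsNewformOf W f)
    (ha : W.frobeniusTrace 2 = -1) (hodd : Odd W.tamagawaProduct) (hΔ : minimalDiscriminantInt W % 8 = 3 ∨ minimalDiscriminantInt W % 8 = 5)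
    {G : IwasawaAlgebra 2} (hG : iwasawaToPowerSeries 2 G = padicLFunction f (unitRoot W 2 : ℚ_[2])) (hμ : mu G = 0) (h1 : HasOrderAtNegTwo G 1)
    (hsym : ‖(ratPlusSymbol f 0 : ℚ_[2])‖ = 1) (hlam : lam G < 9)
    {κ : ZpExtension ℚ 2} {γ : Field.absoluteGaloisGroup ℚ} (hκ : κ.IsCyclotomic) (hγ : κ.IsTopGenerator γ)
    (hγ' : IsCyclotomicVariable 2 γ) (S : Finset ℕ) (hS1 : ∀ n ∈ S, 1 ≤ n)
    (hS : ∀ n ∈ S, (W.baseChange (κ.layer n)).mordellWeilRank < (W.baseChange (κ.layer (n + 1))).mordellWeilRank) : S.card ≤ 1 := by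
  by_contra hlt
  have h2 : 1 < S.card := by omega
  obtain ⟨a, ha', b, hb', hab⟩ := Finset.one_lt_card.mp h2
  rcases Nat.lt_or_gt_of_ne hab with h | h
  · have := lam_ge_of_two_growthLayers_of_negRoad W h17 hord hf ha hodd hΔ hG hμ h1 hsym hκ hγ hγ' (hS1 a ha') h (hS a ha') (hS b hb')
    have h2a : 2 ≤ 2 ^ a := by simpa using Nat.pow_le_pow_right two_pos (hS1 a ha')
    have h2b : 2 ^ (a + 1) ≤ 2 ^ b := Nat.pow_le_pow_right two_pos h
    rw [pow_succ] at h2b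
    omega
  · have := lam_ge_of_two_growthLayers_of_negRoad W h17 hord hf ha hodd hΔ hG hμ h1 hsym hκ hγ hγ' (hS1 b hb') h (hS b hb') (hS a ha')
    have h2b : 2 ≤ 2 ^ b := by simpa using Nat.pow_le_pow_right two_pos (hS1 b hb')
    have h2a : 2 ^ (b + 1) ≤ 2 ^ a := Nat.pow_le_pow_right two_pos h
    rw [pow_succ] at h2a
    omega

end Summit.BirchSwinnertonDyer.BirchSwinnertonDyer.Theorems.AlignedTransportAtTwoCyclotomicLayerRoadBinary
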